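import Literature.NumberTheory.Sieve.FriedlanderIwaniecPrimesEnlargingModuli
import HarnessLib

/-!
# Friedlander–Iwaniec, *The polynomial `X² + Y⁴` captures its primes*, §13: Proposition 13.1 before the choice of `P`

[FI, §13, proof of Proposition 13.1, p. 53 of arXiv:math/9811185]:

> "Applying (12.3) to `V(D⁺)` in (13.4) we obtain
> `V(D) ≪ {D^{1/3}P^{5/3}(RS)^{2/3} + (DP)⁻¹(RS)^{3/2} + P(R+S)^{1/4}(RS)^{3/4} + DP³ + P⁻²RS}(PRS)^ε ‖α‖²`.
> We choose `P = D^{-1/2}(R+S)^{-1/8}(RS)^{3/8}` getting (13.5)."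

Here (12.3) is Proposition 12.1, `V(D) ≤ 𝓛(D, R, S) Σ_r Σ_s τ(r)|α_{rs}|²`, which is not yet in the
tree. This file PROVES the displayed step with (12.3) as an explicit hypothesis on the three levels
`D⁺ = 2^j DP²` (`j = 0, 1, 2`) and with explicit constants, leaving only the choice of `P` (pure
optimisation in `D, R, S`) to the assembly of Proposition 13.1 / 14.1:

* `jtV_split` — `V_{(D₁, D₃]} = V_{(D₁, D₂]} + V_{(D₂, D₃]}`;
* `sum_primes_normSq_dvd_le_tau` — `Σ_p Σ_{r,s} |α_{rs}|²[p ∣ r] ≤ Σ_{r,s} τ(r)|α_{rs}|²` (the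
  primes dividing `r` are among its `τ(r)` divisors): this is how the weight `τ(r)` of (12.3)/(13.5)
  absorbs the sum over `p` of the trivial estimates;
* **`jtV_le_of_level_bounds`** — for every `ε > 0` there are `C ≥ 1`, `P₀` such that for
  `P ≥ P₀`, `2D < P²`, coefficients `α_{rs}` supported on `(r, s) = 1`, and any bounds
  `V(2^jDP²) ≤ L_j Σ τ(r)|α_{rs}|²` (`j = 0, 1, 2`):
  `V(D) ≤ {16 P log(2P) (L₀ + L₁ + L₂) + 8 P⁻¹ log(2P) (D + (R/P + 1) S · C (4RS)^ε)} Σ τ(r)|α_{rs}|²`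
  — the bracket is the printed `{… + DP³ + …}` once `L_j` is the bound (12.4) at `D⁺ = 2^jDP²`,
  and `P⁻¹ log(2P)(D + RS P⁻¹ (RS)^ε)` is the printed `(DP⁻¹ + P⁻²RS)(RS)^ε`.

No definitions, no named facts; Proposition 12.1 enters only as the hypotheses `L_j`.
-/

open Finset
open scoped Nat ArithmeticFunction.sigma

namespace Literature.NumberTheory.Sieve.FriedlanderIwaniecPrimes

/-- `V_{(D₁, D₃]} = V_{(D₁, D₂]} + V_{(D₂, D₃]}` for `D₁ ≤ D₂ ≤ D₃`. [folklore] -/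
private theorem jtV_split {D₁ D₂ D₃ : ℕ} (h₁ : D₁ ≤ D₂) (h₂ : D₂ ≤ D₃) (R S : ℕ) (α : ℕ → ℕ → ℂ) :
    jtV D₁ D₃ R S α = jtV D₁ D₂ R S α + jtV D₂ D₃ R S α := by
  rw [jtV_def, jtV_def, jtV_def, Finset.sum_Ioc_consecutive _ h₁ h₂]

/-- `V ≥ 0`. [folklore] -/
private theorem jtV_nonneg'' (D₁ D₂ R S : ℕ) (α : ℕ → ℕ → ℂ) : 0 ≤ jtV D₁ D₂ R S α := by
  rw [jtV_def]; positivity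

/-- **The primes dividing `r` are among its divisors**: for a finite set `Pr` (of primes, in the
source) and coefficients on `R < r ≤ 2R`, `S < s ≤ 2S`,
`Σ_{p ∈ Pr} Σ_{r,s} |α_{rs}|² [p ∣ r] ≤ Σ_{r,s} τ(r) |α_{rs}|²`.
[cite: FriedlanderIwaniecAnnals1998, §13 proof of Proposition 13.1] -/
theorem sum_primes_normSq_dvd_le_tau (Pr : Finset ℕ) (R S : ℕ) (α : ℕ → ℕ → ℂ) :
    ∑ p ∈ Pr, ∑ r ∈ Ioc R (2 * R), ∑ s ∈ Ioc S (2 * S),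
        ‖(fun r s => if p ∣ r then α r s else 0) r s‖ ^ 2 ≤
      ∑ r ∈ Ioc R (2 * R), ∑ s ∈ Ioc S (2 * S), (σ 0 r : ℝ) * ‖α r s‖ ^ 2 := by
  rw [Finset.sum_comm]
  refine Finset.sum_le_sum fun r hr => ?_
  have hr0 : r ≠ 0 := by have := (Finset.mem_Ioc.mp hr).1; omega
  rw [Finset.sum_comm]
  refine Finset.sum_le_sum fun s _ => ?_
  have hterm : ∀ p ∈ Pr, ‖(fun r s => if p ∣ r then α r s else 0) r s‖ ^ 2 =
      if p ∣ r then ‖α r s‖ ^ 2 else 0 := by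
    intro p _
    dsimp only
    split_ifs <;> simp
  rw [Finset.sum_congr rfl hterm, ← Finset.sum_filter, Finset.sum_const, nsmul_eq_mul]
  refine mul_le_mul_of_nonneg_right ?_ (by positivity)
  rw [ArithmeticFunction.sigma_zero_apply]
  exact_mod_cast Finset.card_le_card fun p hp => by
    rw [Finset.mem_filter] at hp
    exact Nat.mem_divisors.mpr ⟨hp.2, hr0⟩

/-- **Proposition 13.1 before the choice of `P`** ("Applying (12.3) to `V(D⁺)` in (13.4) we
obtain …"): for every `ε > 0` there are `C ≥ 1` and `P₀` such that for all `P ≥ P₀`, `D` with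
`2D < P²`, `R, S`, coefficients `α_{rs}` supported on `(r, s) = 1`, and any numbers `L₀, L₁, L₂` with
`V(2^jDP²) ≤ L_j Σ τ(r)|α_{rs}|²` (`j = 0, 1, 2`; in the source, Proposition 12.1 at `D⁺ = 2^jDP²`),
`V(D) ≤ {16 P log(2P)(L₀ + L₁ + L₂) + 8 P⁻¹ log(2P)(D + (R/P + 1) S · C(4RS)^ε)} Σ τ(r)|α_{rs}|²`.
[cite: FriedlanderIwaniecAnnals1998, Proposition 13.1 (proof, display before "We choose P")] -/
theorem jtV_le_of_level_bounds {ε : ℝ} (hε : 0 < ε) :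
    ∃ C : ℝ, 1 ≤ C ∧ ∃ P₀ : ℕ, ∀ (P D R S : ℕ), P₀ ≤ P → 2 * D < P ^ 2 → ∀ α : ℕ → ℕ → ℂ,
      (∀ r s, α r s ≠ 0 → r.Coprime s) → ∀ L₀ L₁ L₂ : ℝ,
      jtV (D * P ^ 2) (2 * (D * P ^ 2)) R S α ≤
        L₀ * ∑ r ∈ Ioc R (2 * R), ∑ s ∈ Ioc S (2 * S), (σ 0 r : ℝ) * ‖α r s‖ ^ 2 →
      jtV (2 * (D * P ^ 2)) (4 * (D * P ^ 2)) R S α ≤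
        L₁ * ∑ r ∈ Ioc R (2 * R), ∑ s ∈ Ioc S (2 * S), (σ 0 r : ℝ) * ‖α r s‖ ^ 2 →
      jtV (4 * (D * P ^ 2)) (8 * (D * P ^ 2)) R S α ≤
        L₂ * ∑ r ∈ Ioc R (2 * R), ∑ s ∈ Ioc S (2 * S), (σ 0 r : ℝ) * ‖α r s‖ ^ 2 →
      jtV D (2 * D) R S α ≤
        (16 * P * Real.log (2 * P) * (L₀ + L₁ + L₂) +
          8 * (Real.log (2 * P) / P) * (D + ((R : ℝ) / P + 1) * S * (C * ((4 : ℝ) * R * S) ^ ε))) *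
        ∑ r ∈ Ioc R (2 * R), ∑ s ∈ Ioc S (2 * S), (σ 0 r : ℝ) * ‖α r s‖ ^ 2 := by
  obtain ⟨C, hC1, hC⟩ := jtV_le_trivial_of_dvd_rpow hε
  obtain ⟨P₀, hP₀⟩ := jtV_le_enlarged_principle
  refine ⟨C, hC1, P₀ + 1, fun P D R S hP hDP α hαc L₀ L₁ L₂ h0 h1 h2 => ?_⟩
  have hP1 : 1 ≤ P := by omega
  have hPpos : (0 : ℝ) < P := by exact_mod_cast hP1
  have hP1r : (1 : ℝ) ≤ P := by exact_mod_cast hP1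
  set Nτ : ℝ := ∑ r ∈ Ioc R (2 * R), ∑ s ∈ Ioc S (2 * S), (σ 0 r : ℝ) * ‖α r s‖ ^ 2 with hNτ
  have hNτ0 : 0 ≤ Nτ := by rw [hNτ]; positivity
  have hlog : 0 ≤ Real.log (2 * P) := Real.log_nonneg (by linarith)
  have hmain := hP₀ P D R S (by omega) hDP α
  -- the enlarged levels
  have hDP2 : D * P ^ 2 ≤ 2 * (D * P ^ 2) := by omega
  have hsplit : jtV (D * P ^ 2) (8 * (D * P ^ 2)) R S α =
      jtV (D * P ^ 2) (2 * (D * P ^ 2)) R S α + jtV (2 * (D * P ^ 2)) (4 * (D * P ^ 2)) R S α +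
        jtV (4 * (D * P ^ 2)) (8 * (D * P ^ 2)) R S α := by
    rw [jtV_split (D₂ := 2 * (D * P ^ 2)) (by omega) (by omega),
      jtV_split (D₁ := 2 * (D * P ^ 2)) (D₂ := 4 * (D * P ^ 2)) (by omega) (by omega), add_assoc]
  have hlev : jtV (D * P ^ 2) (8 * (D * P ^ 2)) R S α ≤ (L₀ + L₁ + L₂) * Nτ := by
    rw [hsplit]; linarith
  -- the trivial estimates, summed over `p`
  set Pr := (Ioc P (2 * P)).filter Nat.Prime with hPr
  have hPr' : ∀ p ∈ Pr, p.Prime ∧ P < p ∧ p ≤ 2 * P := by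
    intro p hp
    rw [hPr, Finset.mem_filter, Finset.mem_Ioc] at hp
    exact ⟨hp.2, hp.1.1, hp.1.2⟩
  set K : ℝ := (D : ℝ) + ((R : ℝ) / P + 1) * S * (C * ((4 : ℝ) * R * S) ^ ε) with hK
  have hK0 : 0 ≤ K := by rw [hK]; positivity
  have htriv : ∀ p ∈ Pr, Real.log p / p * jtV D (2 * D) R S (fun r s => if p ∣ r then α r s else 0) ≤
      Real.log (2 * P) / P * (K * ∑ r ∈ Ioc R (2 * R), ∑ s ∈ Ioc S (2 * S),
        ‖(fun r s => if p ∣ r then α r s else 0) r s‖ ^ 2) := by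
    intro p hp
    obtain ⟨hpp, hP₁, hP₂⟩ := hPr' p hp
    have hp0 : (0 : ℝ) < p := by exact_mod_cast hpp.pos
    -- the weight
    have hw : Real.log p / p ≤ Real.log (2 * P) / P := by
      have hlogp : Real.log p ≤ Real.log (2 * P) := Real.log_le_log hp0 (by exact_mod_cast hP₂)
      have hlogp0 : 0 ≤ Real.log p := Real.log_nonneg (by exact_mod_cast hpp.one_lt.le)
      calc Real.log p / p ≤ Real.log p / P :=
            div_le_div_of_nonneg_left hlogp0 hPpos (by exact_mod_cast hP₁.le)
        _ ≤ Real.log (2 * P) / P := div_le_div_of_nonneg_right hlogp hPpos.le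
    have hw0 : 0 ≤ Real.log p / p :=
      div_nonneg (Real.log_nonneg (by exact_mod_cast hpp.one_lt.le)) hp0.le
    -- the trivial estimate for `α[p ∣ r]`
    have ht := hC D R S hpp (fun r s => if p ∣ r then α r s else 0)
      (fun r s h => by
        by_contra hpr
        exact h (by simp [hpr]))
      (fun r s h => by
        by_cases hpr : p ∣ r
        · have h' : α r s ≠ 0 := by simpa [hpr] using h
          exact hαc r s h'
        · exact absurd (by simp [hpr]) h)
    have hKp : (D : ℝ) + ((R : ℝ) / p + 1) * S * (C * ((4 : ℝ) * R * S) ^ ε) ≤ K := by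
      rw [hK]
      have : (R : ℝ) / p ≤ (R : ℝ) / P :=
        div_le_div_of_nonneg_left (Nat.cast_nonneg _) hPpos (by exact_mod_cast hP₁.le)
      have hC0 : 0 ≤ C * ((4 : ℝ) * R * S) ^ ε := by positivity
      nlinarith [this, hC0, Nat.cast_nonneg (α := ℝ) S, mul_nonneg (Nat.cast_nonneg (α := ℝ) S) hC0]
    have hN0 : 0 ≤ ∑ r ∈ Ioc R (2 * R), ∑ s ∈ Ioc S (2 * S),
        ‖(fun r s => if p ∣ r then α r s else 0) r s‖ ^ 2 := by positivity
    calc Real.log p / p * jtV D (2 * D) R S (fun r s => if p ∣ r then α r s else 0)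
        ≤ Real.log p / p * (K * ∑ r ∈ Ioc R (2 * R), ∑ s ∈ Ioc S (2 * S),
            ‖(fun r s => if p ∣ r then α r s else 0) r s‖ ^ 2) :=
          mul_le_mul_of_nonneg_left (ht.trans (mul_le_mul_of_nonneg_right hKp hN0)) hw0
      _ ≤ Real.log (2 * P) / P * (K * ∑ r ∈ Ioc R (2 * R), ∑ s ∈ Ioc S (2 * S),
            ‖(fun r s => if p ∣ r then α r s else 0) r s‖ ^ 2) :=
          mul_le_mul_of_nonneg_right hw (mul_nonneg hK0 hN0)
  have htrivsum : ∑ p ∈ Pr, Real.log p / p *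
      jtV D (2 * D) R S (fun r s => if p ∣ r then α r s else 0) ≤ Real.log (2 * P) / P * (K * Nτ) := by
    refine (Finset.sum_le_sum htriv).trans ?_
    rw [← Finset.mul_sum, ← Finset.mul_sum]
    refine mul_le_mul_of_nonneg_left (mul_le_mul_of_nonneg_left ?_ hK0) (by positivity)
    exact sum_primes_normSq_dvd_le_tau Pr R S α
  -- assemble
  have h16 : 0 ≤ 16 * (P : ℝ) * Real.log (2 * P) := by positivity
  calc jtV D (2 * D) R S α
      ≤ 16 * P * Real.log (2 * P) * jtV (D * P ^ 2) (8 * (D * P ^ 2)) R S α +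
          8 * ∑ p ∈ Pr, Real.log p / p * jtV D (2 * D) R S (fun r s => if p ∣ r then α r s else 0) :=
        hmain
    _ ≤ 16 * P * Real.log (2 * P) * ((L₀ + L₁ + L₂) * Nτ) + 8 * (Real.log (2 * P) / P * (K * Nτ)) := by
        have a := mul_le_mul_of_nonneg_left hlev h16
        linarith
    _ = (16 * P * Real.log (2 * P) * (L₀ + L₁ + L₂) + 8 * (Real.log (2 * P) / P) * K) * Nτ := by ring

end Literature.NumberTheory.Sieve.FriedlanderIwaniecPrimes
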